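import Literature.AlgebraicGeometry.Hyperkaehler.KugaSatakeCorrespondenceHyperkaehler
import Literature.AlgebraicGeometry.Hyperkaehler.OGradySixType
import Literature.AlgebraicGeometry.HodgeTheory.DominatedByPowersHodgeConjecture
import HarnessLib
import HarnessLib.Audit

/-!
# OpenQuestionsFloccari — the open questions named in Floccari, Compositio Math. 160 (2024) §5 and O'Grady, IMRN 2021 §1.1 (with the 2026 sequel Floccari–Fu, Conj. 1.4): the Kuga–Satake Hodge conjecture for projective hyperkähler varieties, and domination by the Kuga–Satake variety — CONJECTURE LEAF (nothing asserted)

HONEST FRAMING: typed ≠ proved ≠ endorsed.  Nothing in this file asserts `HodgeConjecture`, `HC_AV`,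
`W₆`, `HC_Kum4Type` or either statement below.  Cross-ladder literature-typing layer D-0088(4),
tranche LT-H4 (open-question harvest), seat `hodge-lit-oqh-2`; consumers: the plan-novel ∕ lens seats
(`oqh`, `transfer`) on `HodgeConjecture`, the Kuga–Satake road of the stage-4 scoping
(`Summit.HodgeConjecture.CorCM.Stage4.KSH_K3` ∕ `KSH_K3_Betti`, routes `Theses/KugaSatakeSaturation`,
`Theses/KugaSatakeDescent`), rung H3 ∕ H3-outlook of LADDER-HodgeAV.  Conjecture LEAF: nothing but
`@[conjecture]` definitions, imports `Literature.*` ∕ `HarnessLib` only.  The per-variety PROPERTY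
quantified here — "the Kuga–Satake correspondence of the `2n`-dimensional `X` is algebraic" on the real
carriers, `Hyperkaehler.IsKSCorrespondenceAlgebraicHK` — is the dimension-`2n` twin (file
`Literature/AlgebraicGeometry/Hyperkaehler/KugaSatakeCorrespondenceHyperkaehler.lean`) of the surface
predicate `HodgeTheory.IsKSCorrespondenceAlgebraicBetti` behind `KSH_K3_Betti`.

## Sources and what they leave open (read at source; locators = materialised arXiv texts)

* [Flo24] S. Floccari, *Sixfolds of generalized Kummer type and K3 surfaces*, Compos. Math. 160 (2024)
  388–410 (arXiv:2210.02948) [`Floccari2024`; REFEREED].  §1 [corpus:paper-arxiv-2210.02948 p0003:L38–L40],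
  verbatim: "the conjecture predicts the existence of an algebraic cycle inducing an embedding of the
  transcendental Hodge structure of the surface into the second cohomology of `KS(S) × KS(S)`. It is
  known to hold in many cases for K3 surfaces of Picard number at least `17` ([Morrison]), but it is
  wide open otherwise. There are a couple of families of K3 surfaces of general Picard rank `16` for
  which the conjecture is known […] [Paranjape] […] [ILP]."  §5.1 [p0016:L58–L61], verbatim:
  "**Conjecture** (Kuga-Satake Hodge conjecture). Let `X` be a projective hyper-Kähler variety. There
  exists an algebraic cycle `ζ` on `X × KS(X) × KS(X)` such that the associated correspondence induces an
  embedding of Hodge structures `ζ_* : H²_tr(X) ↪ H²(KS(X) × KS(X))`."  (Printed number: the fourth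
  numbered item of §5 in the arXiv text; the Acknowledgements name the later "Corollary 5.8", so this is
  Conjecture 5.4 modulo the journal's renumbering — cited below by section and name.)  Thm. 1.3 / §5
  (REFEREED): the conjecture holds for every projective K3 surface `S` with
  `H²_tr(S, ℚ) ↪ Λ_{Kum³}(2) ⊗ ℚ` isometrically (the rank-16 families of the sixfolds' K3 surfaces `S_K`).
* [OG21] K. G. O'Grady, *Compact tori associated to hyperkähler manifolds of Kummer type*, IMRN 2021
  no. 16, 12356–12419 (arXiv:1805.12075) [`OGrady2021KummerTori`; REFEREED], §1.1
  [corpus:paper-arxiv-1805.12075 p0002:L18–L20], verbatim: "if `X` is projective, the Hodge conjecture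
  predicts the existence of a Kuga-Satake algebraic cycle on `X × KS(X,L) × KS(X,L)` realizing the
  homomorphism of H.S.'s in (1.1) [`H²(X)_pr ⊂ H¹(KS(X,L)) ⊗ H¹(KS(X,L))`]. There are very few families of
  hyperkähler manifolds for which one has a geometric description of the corresponding Kuga-Satake
  varieties and a proof of existence of a Kuga-Satake algebraic cycle: Kummer surfaces [Morrison] and K3
  surfaces obtained as minimal desingularization of the double cover of a plane ramified over 6 lines
  [Paranjape]."  (The other open sentence of [OG21], §1.1 L31 — "This result suggests that we will be
  able to describe explicitly locally complete families of projective hyperkählers of Kummer type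
  starting from the locally complete families of abelian fourfolds of Weil type" — is a programme, not a
  proposition, and is not typed; [OG21] Thm. 1.1 (1) and Thm. 1.5 are typed as
  `Hyperkaehler.Markman2023_thirdCohomology_kummerType_discOneWeilFourfold` and
  `Hyperkaehler.OGradyVoisin2022_thirdJacobian_kugaSatake_kummerType`.)
* STATUS in print of the Kuga–Satake Hodge conjecture, by deformation type (each graded):
  K3 surfaces (`n = 1`): OPEN in general (vG 2000 §10; [Flo24] "wide open otherwise"), known for
  `ρ ≥ 17`, the Paranjape and ILP families, the [Flo24] Thm. 1.3 families, and the `U³ ⊕ ⟨-m⟩` families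
  of Floccari, Geom. Topol. 30 (2026) Thm. 5.11 [`Floccari2026`; REFEREED] — the surface statement is the
  typed `Summit.HodgeConjecture.CorCM.Stage4.KSH_K3_Betti`;  `Kumⁿ`-type (`n ≥ 2`): a THEOREM — C. Voisin,
  Math. Z. 300 (2022) Thm. 4.1 [`Voisin2022FootnotesOGradyMarkman`; REFEREED] (tree record in `J³(X)`-form:
  `Hyperkaehler.OGradyVoisin2022_thirdJacobian_kugaSatake_kummerType`);  `K3^[n]`-type: OPEN — M. Varesco,
  Math. Z. 305 (2023) §5 [`Varesco2023`; REFEREED] [corpus:paper-arxiv-2304.02519 p0018:L1], verbatim: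
  "The Kuga–Satake Hodge conjecture has not been proven for hyperkähler manifolds of `K3^[n]`-type. In
  dimension six, this conjecture follows from the construction in [Flo24] for the families of
  hyperkähler manifolds of `K3^[3]`-type which are resolution of the quotient of a hyperkähler manifold of
  generalized Kummer type of dimension six", and for `K3^[n]`-type `X` with `H²_tr(X, ℚ) ↪ U³_ℚ ⊕ ⟨-a⟩_ℚ`
  a PREPRINT theorem (Floccari–Fu 2026, *The hyper-Kummer construction*, arXiv:2607.07528, Thm. K (i)
  [`FloccariFu2026HyperKummer`; PREPRINT]);  OG6: PREPRINT theorem for "OG6-resolutions" (loc. cit.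
  Thm. K (iii));  OG10: no statement found (presearch below).
* [FF26] S. Floccari, L. Fu, arXiv:2607.07528 (2026) [PREPRINT], **Conjecture 1.4**
  [corpus:paper-arxiv-2607.07528 p0013:L21–L31], verbatim: "The Kuga–Satake construction associates an
  abelian variety `KS(X)` with any hyper-Kähler variety `X`. […] A general expectation for the motives of
  hyper-Kähler varieties is the following conjecture.  Conjecture 1.4. Let `X` be a projective
  hyper-Kähler variety, and let `KS(X)` be the associated Kuga–Satake abelian variety. Then `X` is
  motivated by `KS(X)`, i.e., the motive of `X` belongs to the thick tensor subcategory of motives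
  generated by the motive of `KS(X)`.  The conjecture depends on the choice of a suitable category of
  motives. In the category of André motives, the conjecture holds for any K3 surface by [André], and it
  has been verified for any hyper-Kähler variety of known deformation type in [Sol21a, FFZ21]. In the
  setting of homological motives, the conjecture is wide open already for K3 surfaces."

presearch: "Kuga-Satake Hodge conjecture hyperkähler OG10 ∕ K3^[n] algebraic cycle" → corpus: [Var23]
§5 (quoted), [FF26] §1.6 (quoted), [Flo24] §5; galaxy (`Kuga-Satake Hodge conjecture|generalized Kummer
type`, all stars): 1 unrelated thesis hit; no OG10 statement found.

## Rendering and which rung each statement feeds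

* `KSH_Hyperkaehler` — [Flo24] §5 Conjecture ∕ [OG21] §1.1 AS PRINTED for "projective hyper-Kähler
  variety of dimension `2n`": `Hyperkaehler.IsProjectiveIrreducibleSymplectic (2 * n) X` (file
  `Hyperkaehler/OGradySixType`: smooth projective, simply connected, `H^{2,0}` spanned by a symplectic
  form) ⟹ `Hyperkaehler.IsKSCorrespondenceAlgebraicHK n hX.1` (the transcendental-lattice form; the
  `H²_prim`-form of [OG21] has isogenous Kuga–Satake varieties, [Flo24] Remark before the Conjecture).
  Feeds: the Kuga–Satake road (`KSH_K3_Betti` is its `n = 1` shadow; routes KugaSatakeSaturation ∕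
  KugaSatakeDescent), the `transfer` lens ([Var23] Cor. 4.6: KSH(`X`) + `B₂(X)` ⟹ every Hodge similitude of
  `T(X)` is algebraic — the mechanism behind `Hyperkaehler.Varesco2023_hodgeSimilitude_algebraic_kummerType`),
  and the H3 outlook (for `Kumⁿ` it is known; it is the first input of every `Kumⁿ` Hodge proof).
* `Hyperkaehler_dominatedByKugaSatake` — the cohomological SHADOW of [FF26] Conj. 1.4 (algebraic
  correspondences instead of homological motives; domination is IMPLIED by membership in the thick
  tensor subcategory — Arapura 2006 Lemma 1.1 — so this is WEAKER than print, never stronger): for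
  every projective irreducible symplectic `X` of dimension `2n`, every Fujiki form, Hodge model,
  presentation `(T, H, P, j)` of `(H²_tr(X, ℚ), q_X)` and EVERY Kuga–Satake variety `(A, B, θ)` of it
  (Floccari's `KS'(X)`; `KS(X)` is isogenous to a power of it, so "dominated by powers of `KS(X)`" and
  "of `A`" agree), `HodgeTheory.IsDominatedByPowers (2 * n) X A.dim A.X`.  Feeds: H3 ∕ H3-outlook (with
  `KS(X) ~ J³(X)⁴`, O'Grady Thm. 1.5, this is `Theorems/OpenQuestionsFloccariVaresco`'s
  `KummerType_dominatedByFourfoldPowers`, which with Arapura's fact yields `HC_KummerType` and all powers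
  — glue file), the stage-4 road R1 (André motives), `oqh` lens.
-/

noncomputable section

open Literature.AlgebraicGeometry Literature.AlgebraicGeometry.Motives
  Literature.AlgebraicGeometry.HodgeTheory Literature.AlgebraicGeometry.Hyperkaehler
open scoped TensorProduct

-- `Summit.<Summit>.<Problem>` is the mandated summit-side namespace (CONVENTIONS §2); for the
-- single-conjunct summit `HodgeConjecture` the two coincide, so the duplicate is deliberate.
set_option linter.dupNamespace false

namespace Summit.HodgeConjecture.HodgeConjecture.Theorems

/-- OPEN CONJECTURE — **the Kuga–Satake Hodge conjecture for projective hyperkähler varieties**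
(Floccari 2024 §5: "Let `X` be a projective hyper-Kähler variety. There exists an algebraic cycle `ζ` on
`X × KS(X) × KS(X)` such that the associated correspondence induces an embedding of Hodge structures
`ζ_* : H²_tr(X) ↪ H²(KS(X) × KS(X))`"; O'Grady 2021 §1.1: "the Hodge conjecture predicts the existence of
a Kuga-Satake algebraic cycle on `X × KS(X,L) × KS(X,L)`").  For every `n ≥ 1` and every projective
irreducible symplectic `X` of dimension `2n` (`Hyperkaehler.IsProjectiveIrreducibleSymplectic (2 * n) X`),
the Kuga–Satake correspondence of `X` is algebraic on the real carriers
(`Hyperkaehler.IsKSCorrespondenceAlgebraicHK n _`: for all Fujiki forms, Hodge models, presentations of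
`(H²_tr(X, ℚ), q_X)`, van Geemen choices and Kuga–Satake varieties `(A, B, θ)`, an algebraic
correspondence `H²(X(ℂ); ℂ) → H²((A × A)(ℂ); ℂ)` restricting to the Kuga–Satake class map).  STATUS
(module docstring, graded): K3 surfaces — OPEN in general ("wide open otherwise", Floccari 2024 §1), the
typed `Stage4.KSH_K3_Betti` being the `n = 1` surface form — recorded THEOREM on the locus
`H²_tr(S, ℚ) ↪ (U³ ⊕ ⟨-m⟩) ⊗ ℚ` BY NAME:
`Surfaces.Floccari2026_kugaSatakeCorrespondence_algebraic_of_K3_of_transcendental_embedding` (Floccari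
2026 Thm. 5.11 (i), p465151); `Kumⁿ`-type, `n ≥ 2` — THEOREM (Voisin 2022 Thm. 4.1, REFEREED), recorded
BY NAME in exactly this predicate: `Hyperkaehler.Voisin2022_kugaSatakeCorrespondence_algebraic_kummerType`
(p464953; so `KSH_Hyperkaehler` restricted to `IsOfGeneralizedKummerType n X`, `n ≥ 2`, follows from that
record in one line); `K3^[n]`-type — OPEN ("has not been proven", Varesco 2023 §5), PREPRINT theorem for
`H²_tr ↪ U³ ⊕ ⟨-a⟩` (Floccari–Fu 2026 Thm. K (i)); OG6-resolutions — PREPRINT theorem (loc. cit. (iii));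
OG10 — no statement found.  WHAT THE PREDICATE BUYS (recorded BY NAME, gen. 3 of this seat): for
two `X`, `X'` satisfying it, every Hodge similitude of rational transcendental lattices `T(X') ⥲ T(X)`
becomes algebraic after the Lefschetz twist (`Hyperkaehler.Varesco2023_lefschetzTwisted_transcendentalHodgeSimilitude_algebraic`,
Varesco 2023 Thm. 4.5) and is algebraic under `B(X)` (`….Varesco2023_transcendentalHodgeSimilitude_algebraic_of_lefschetzStandard`,
Cor. 4.6; p475653); the predicate transfers along algebraic transcendental similitudes
(`Hyperkaehler.Floccari2026_kugaSatakeCorrespondence_algebraic_transfer`, p469299); `Kumⁿ`-type / `K3^[m]`-type /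
K3 ⇒ `IsProjectiveIrreducibleSymplectic` is `Hyperkaehler.Beauville1983_irreducibleSymplectic_of_kummerType` /
`…_of_k3HilbertType` / `Huybrechts2016_irreducibleSymplectic_of_K3` (p477430).  Never asserted; an explicit
hypothesis wherever used.
[cite: Floccari2024, §5.1 Conjecture "Kuga-Satake Hodge conjecture" (4th numbered item of §5, arXiv:2210.02948) and §1 (status)]
[cite: OGrady2021KummerTori, §1.1 (arXiv:1805.12075 p. 2, "the Hodge conjecture predicts the existence of a Kuga-Satake algebraic cycle")]
[cite: Varesco2023, §5 (after Thm. 5.4: "has not been proven for hyperkähler manifolds of K3^[n]-type")]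
[cite: Voisin2022FootnotesOGradyMarkman, Thm. 4.1 (the Kumⁿ case, proved)] -/
@[conjecture] def KSH_Hyperkaehler : Prop :=
  ∀ (n : ℕ), 1 ≤ n → ∀ ⦃X : SchemeOver ℂ⦄ (hX : IsProjectiveIrreducibleSymplectic (2 * n) X),
    IsKSCorrespondenceAlgebraicHK n hX.1

/-- OPEN CONJECTURE (cohomological shadow of a PREPRINT conjecture) — **every projective hyperkähler
variety is dominated by the powers of its Kuga–Satake variety** (Floccari–Fu 2026, Conj. 1.4: "Let `X`
be a projective hyper-Kähler variety, and let `KS(X)` be the associated Kuga–Satake abelian variety. Then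
`X` is motivated by `KS(X)`, i.e., the motive of `X` belongs to the thick tensor subcategory of motives
generated by the motive of `KS(X)`"; "In the setting of homological motives, the conjecture is wide open
already for K3 surfaces").  Rendering: for every `n ≥ 1`, every projective irreducible symplectic `X` of
dimension `2n`, every Fujiki form `b`, Hodge-symmetric Hodge model `M`, presentation `(T, H, P, j)` of
`(H²_tr(X, ℚ), q_X)` with `h^{2,0} = 1` (`Hyperkaehler.IsTranscendentalPartHK`) and every Kuga–Satake
variety `(A, B, θ)` of `(T, H, P)` (`HodgeTheory.IsKugaSatakeVarietyBetti`; Floccari's `KS'(X)`, of which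
`KS(X)` is isogenous to a power), every `Hᵏ(X(ℂ); ℂ)` is spanned by images of algebraic correspondences
from powers of `A` (`HodgeTheory.IsDominatedByPowers (2 * n) X A.dim A.X`, Arapura 2006 Lemma 1.1 form).
Membership in the thick tensor subcategory generated by `𝔥(KS(X))` IMPLIES this domination (a direct
summand of a sum of twisted `𝔥(KS(X)ᵉ)` has cohomology spanned by correspondence images), so the
statement is WEAKER than print, never stronger.  STATUS: `Kum²`, `Kum³`, OG6-resolutions, K3 ∕ `K3^[n]`
with `H²_tr ↪ U³ ⊕ ⟨-a⟩` — PREPRINT theorem (Floccari–Fu 2026 Thm. K); K3 surfaces in general — open;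
`Kumⁿ`, `n ≥ 4` — open, no statement in print (its `J³(X)`-specialisation is
`KummerType_dominatedByFourfoldPowers` of `Theorems/OpenQuestionsFloccariVaresco`).  Never asserted.
[cite: FloccariFu2026HyperKummer, Conj. 1.4 and Thm. K (arXiv:2607.07528 pp. 13–14; PREPRINT)]
[cite: Arapura2006, §1 Lemma 1.1 (motivated ⟸ dominated by algebraic correspondences)]
[cite: Floccari2024, §5.1 Remark before the Conjecture (KS of a sub-Hodge structure with Hodge complement is isogenous to a power)] -/
@[conjecture] def Hyperkaehler_dominatedByKugaSatake : Prop :=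
  ∀ (n : ℕ), 1 ≤ n → ∀ ⦃X : SchemeOver ℂ⦄ (hX : IsProjectiveIrreducibleSymplectic (2 * n) X),
  ∀ (b : complexBetti X 2 →ₗ[ℂ] complexBetti X 2 →ₗ[ℂ] ℂ), IsFujikiForm n X b →
  ∀ (M : HodgeModel (2 * n) X) (hM : M.IsHodgeSymmetric)
    (T : Type) [AddCommGroup T] [Module ℚ T] (H : HodgeStructure T 2) (P : H.Polarization)
    (hT : H.hodgeNumber 2 0 = 1) (j : H.Hom (bettiTwoHodgeStructureOfModel hX.1 M hM)),
    IsTranscendentalPartHK hX.1 M hM b H P j →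
  ∀ (A : AbelianVariety ℂ) (B : HodgeModel A.dim A.X) (hB : B.IsHodgeSymmetric)
    (θ : bettiCohomology A.X 1 ≃ₗ[ℚ] CliffordAlgebra.even P.quadraticForm),
    IsKugaSatakeVarietyBetti H P hT A B hB θ →
  IsDominatedByPowers (2 * n) X A.dim A.X

end Summit.HodgeConjecture.HodgeConjecture.Theorems

end
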